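/-
Copyright (c) 2026. All rights reserved.
Released under Apache 2.0 license as described in the file LICENSE.
-/
import Summits.ValiantsHypothesis.ValiantsHypothesis.Theorems.ReadOnceForestSupport
import HarnessLib

/-!
# The acyclicity hypothesis of the free-edge lemmas is necessary: a `3 × 3` witness

`ReadOnceForestSupport` (O-L2-20) proves UNIQUE COMPLETION (`monoOfO_injOn_forest`) and NO
CANCELLATION (`monoOfO_mem_support_forest`) for read-once determinantal templates whose free graph
(non-zero constants) is ACYCLIC.  This file records, in kernel, that ONE free `4`-cycle already
breaks both — with a non-zero determinant and read-once variables: the template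
`E₃ = (1 1 x₀ ; 1 1 0 ; x₁ 0 1)` over `ℚ` has `det = -x₀x₁ ≠ 0`, the identity and the
transposition `(0 1)` are both admissible with the same (empty) monomial, and that monomial — the
constant term — is cancelled (`+1 - 1 = 0`).  As a corollary BY NAME of `monoOfO_injOn_forest`,
the free graph of `E₃` has a cycle (no explicit walk is constructed).  So the free-edge method of
`IsolationRoundsForest` / `ReadOnceForestIsolation` stops exactly at free cycles.
Currency: kernel-certified TIGHTNESS WITNESS for the W4 isolation road (O-L2-21); closes no item;
one data def `E₃` (a concrete matrix); no facts/doors. [this file]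
-/

set_option linter.dupNamespace false

namespace Summit.ValiantsHypothesis.ValiantsHypothesis.Theorems.ReadOnceForestTight

open MvPolynomial SimpleGraph
  Summit.ValiantsHypothesis.ValiantsHypothesis.Theorems.RelationGraphCycles
  Summit.ValiantsHypothesis.ValiantsHypothesis.Theorems.ReadOnceColSparseSupport
  Summit.ValiantsHypothesis.ValiantsHypothesis.Theorems.ReadOnceForestSupport

/-- THE WITNESS: rows `(1, 1, x₀)`, `(1, 1, 0)`, `(x₁, 0, 1)` — read-once in `x₀, x₁`, the four
non-zero constants at rows `{0,1}` × columns `{0,1}` form a free `4`-cycle. [this file] -/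
def E₃ : Matrix (Fin 3) (Fin 3) (Fin 2 ⊕ ℚ) :=
  !![Sum.inr 1, Sum.inr 1, Sum.inl 0;
     Sum.inr 1, Sum.inr 1, Sum.inr 0;
     Sum.inl 1, Sum.inr 0, Sum.inr 1]

/-- `E₃` is READ-ONCE (item 20152's clause). [this file] -/
theorem E₃_readOnce : ∀ p q : Fin 3 × Fin 3, ∀ m : Fin 2,
    E₃ p.1 p.2 = Sum.inl m → E₃ q.1 q.2 = Sum.inl m → p = q := by
  decide

/-- The identity is admissible for `E₃` (it meets the constants `1, 1, 1`). [this file] -/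
theorem E₃_adm_one : ∀ k, ∀ c : ℚ, E₃ ((1 : Equiv.Perm (Fin 3)) k) k = Sum.inr c → c ≠ 0 := by
  intro k c h
  fin_cases k <;> simp [E₃] at h <;> subst h <;> norm_num

/-- The transposition `(0 1)` is admissible for `E₃` (it meets the constants `1, 1, 1`).
[this file] -/
theorem E₃_adm_swap : ∀ k, ∀ c : ℚ, E₃ (Equiv.swap (0 : Fin 3) 1 k) k = Sum.inr c → c ≠ 0 := by
  intro k c h
  fin_cases k <;> simp [E₃, Equiv.swap_apply_def] at h <;> subst h <;> norm_num

/-- Neither the identity nor the transposition `(0 1)` meets a variable: both monomials are `1`.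
[this file] -/
theorem E₃_monoOfO : monoOfO (optLab E₃) (1 : Equiv.Perm (Fin 3)) = 0 ∧
    monoOfO (optLab E₃) (Equiv.swap (0 : Fin 3) 1) = 0 := by
  constructor <;> simp [monoOfO, optLab, E₃, Fin.sum_univ_three, Equiv.swap_apply_def]

/-- The determinant of the witness: `-x₀x₁`. [this file] -/
theorem E₃_det : (E₃.map (Sum.elim MvPolynomial.X MvPolynomial.C)).det =
    -(X 0 * X 1 : MvPolynomial (Fin 2) ℚ) := by
  rw [Matrix.det_fin_three]
  simp [E₃]
  try ring

/-- The determinant of the witness is non-zero. [this file] -/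
theorem E₃_det_ne_zero : (E₃.map (Sum.elim MvPolynomial.X MvPolynomial.C)).det ≠ 0 := by
  rw [E₃_det]
  exact neg_ne_zero.2 (mul_ne_zero (X_ne_zero 0) (X_ne_zero 1))

/-- **UNIQUE COMPLETION FAILS** for `E₃`: two distinct admissible permutations with the same
monomial (they differ by the free `4`-cycle). [this file] -/
theorem E₃_not_injOn : ∃ σ τ : Equiv.Perm (Fin 3), σ ≠ τ ∧
    (∀ k, ∀ c : ℚ, E₃ (σ k) k = Sum.inr c → c ≠ 0) ∧
    (∀ k, ∀ c : ℚ, E₃ (τ k) k = Sum.inr c → c ≠ 0) ∧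
    monoOfO (optLab E₃) σ = monoOfO (optLab E₃) τ :=
  ⟨1, Equiv.swap 0 1, fun h => by simpa using Equiv.congr_fun h 0, E₃_adm_one, E₃_adm_swap,
    E₃_monoOfO.1.trans E₃_monoOfO.2.symm⟩

/-- **NO CANCELLATION FAILS** for `E₃`: the monomial of the admissible identity (the constant
term) is not in the support of the determinant `-x₀x₁` (coefficient `+1 - 1 = 0`). [this file] -/
theorem E₃_cancels :
    monoOfO (optLab E₃) (1 : Equiv.Perm (Fin 3)) ∉
      (E₃.map (Sum.elim MvPolynomial.X MvPolynomial.C)).det.support := by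
  rw [E₃_monoOfO.1, E₃_det, MvPolynomial.mem_support_iff, not_not]
  show constantCoeff (-(X 0 * X 1 : MvPolynomial (Fin 2) ℚ)) = 0
  simp

/-- Hence, by `monoOfO_injOn_forest` BY NAME, the free graph of `E₃` (admissible unlabelled
cells) is NOT acyclic — the acyclicity hypothesis of `ReadOnceForestSupport` cannot be dropped
(by `freeRel_eq` this is the free graph of NON-ZERO constants of the family clause of rung 1‴, so
`E₃` lies outside `readOnceForestDets` exactly by that clause). [this file] -/
theorem E₃_not_forest : ¬ ∀ (u : Fin 3 ⊕ Fin 3) (c : (relGraph fun k j =>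
    (∀ c : ℚ, E₃ j k = Sum.inr c → c ≠ 0) ∧ optLab E₃ k j = none).Walk u u), ¬ c.IsCycle :=
  fun h => absurd (monoOfO_injOn_forest E₃ E₃_readOnce h E₃_adm_one E₃_adm_swap
    (E₃_monoOfO.1.trans E₃_monoOfO.2.symm)) fun h₁ => by simpa using Equiv.congr_fun h₁ 0

end Summit.ValiantsHypothesis.ValiantsHypothesis.Theorems.ReadOnceForestTight
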